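import Summits.Ventures.CertifiedManyBodySolver.Downfold.EmeryOrbitalWeightShell
import HarnessLib

/-!
# The velocity-matched one-band hopping AT THE NODE of a σ contour in closed form:
# `t_node(ε) = scaleT(xNode, xNode; ε) = fsT·(2t_pd² + (t_pp − t_pp′)ε)² / [2(Δ + ε)(t_pd² + t_pp ε)(2t_pd²(Δ + 2ε) + (t_pp − t_pp′)ε²)]`

Venture CertifiedManyBodySolver, cell `pub/hubbard-downfold` (stage S1; INFLATION-RULES-3to1-B §B.69/§B.74: the SCALE leg — the census `EmeryFermiScalePoints*` certifies the
velocity-matched nearest-neighbour hopping `t_eff = scaleT` of the energy-linearised one-band image of a σ set ON ITS FERMI SURFACE and finds `t_eff(x = 0.16) > t_eff(x = 0)` on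
33/33 typed rows; this file and its sequel `EmeryFermiScaleLever` make the nodal part of that sign a theorem), seat hubbard-downfold-mod-4 (technique B, g29); namespace
`Summit.Ventures.CertifiedManyBodySolver.Downfold.Emery`. Sequel of `EmeryFermiSurfaceShapeBox` (`scaleT = fsT/∂_ε charCubic`), `EmeryOrbitalWeightCheck` (`xNode = fsD1/(2fsN1)`),
`EmeryOrbitalWeightNode` (`nodeGap_xNode`) and `EmeryOrbitalWeightShell` (`dcharCubic_diag_eq`, `dcharCubic_node_pos`). Everything PROVED (0 sorry; elementary algebra). WHAT THIS
IS NOT: a statement about any material; `U = 0` one-body kinematics of the σ model as printed.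

* `scaleNodeN = fsT·(2t_pd² + (t_pp − t_pp′)ε)²`, `scaleNodeD = 2(Δ + ε)(t_pd² + t_pp ε)(2t_pd²(Δ + 2ε) + (t_pp − t_pp′)ε²)` (`> 0` in the regime, `scaleNodeD_pos`);
* `dcharCubic_node_mul_fsN1_sq`: `∂_ε charCubic(xNode, xNode; ε)·fsN1² = 8(Δ + ε)(t_pd² + t_pp ε)(2t_pd²(Δ + 2ε) + (t_pp − t_pp′)ε²)` — the nodal energy denominator in closed form
  (from `(Δ + 4t_pp′x + ε + 4t_pp x)·fsN1 = 4(Δ + ε)(t_pd² + t_pp ε)` and `(nodeGap + ε)·fsN1 = 2(2t_pd²(Δ + 2ε) + (t_pp − t_pp′)ε²)` at `x = xNode`);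
* **`scaleT_node_eq`**: `scaleT(xNode, xNode; ε) = scaleNodeN/scaleNodeD` (`fsN1 > 0`); `scaleT_node_pos`.

Sources: three-band model [HybertsenSchluterChristensen1989, Eq. (1)]; energy-linearised one-band image [AndersenEtAl1995, §6]; [folklore] algebra.
-/

noncomputable section

namespace Summit.Ventures.CertifiedManyBodySolver.Downfold.Emery

open Real Set

/-- Numerator of the nodal scale: `scaleNodeN = fsT·(2t_pd² + (t_pp − t_pp′)ε)²` (`fsT = fsD + 2fsN`; `2t_pd² + (t_pp − t_pp′)ε = fsN1/2`). [folklore] -/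
def scaleNodeN (Δ tpd tpp c ε : ℝ) : ℝ := fsT Δ tpd tpp c ε * (2 * tpd ^ 2 + (tpp - c) * ε) ^ 2

/-- Denominator of the nodal scale: `scaleNodeD = 2(Δ + ε)(t_pd² + t_pp ε)(2t_pd²(Δ + 2ε) + (t_pp − t_pp′)ε²)`. [folklore] -/
def scaleNodeD (Δ tpd tpp c ε : ℝ) : ℝ := 2 * (Δ + ε) * (tpd ^ 2 + tpp * ε) * (2 * tpd ^ 2 * (Δ + 2 * ε) + (tpp - c) * ε ^ 2)

/-- `fsN1 = 2·(2t_pd² + (t_pp − t_pp′)ε)`. [folklore] -/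
theorem fsN1_eq_two_mul (tpd tpp c ε : ℝ) : fsN1 tpd tpp c ε = 2 * (2 * tpd ^ 2 + (tpp - c) * ε) := by
  unfold fsN1
  ring

/-- `2·fsN1·xNode = fsD1 = ε(Δ + ε)` (`fsN1 ≠ 0`). [folklore] -/
theorem two_fsN1_mul_xNode {Δ tpd tpp c ε : ℝ} (hN1 : fsN1 tpd tpp c ε ≠ 0) : 2 * fsN1 tpd tpp c ε * xNode Δ tpd tpp c ε = ε * (Δ + ε) := by
  unfold xNode fsD1
  field_simp

/-- **THE NODAL ENERGY DENOMINATOR IN CLOSED FORM**: `∂_ε charCubic(xNode, xNode; ε)·fsN1² = 8(Δ + ε)(t_pd² + t_pp ε)(2t_pd²(Δ + 2ε) + (t_pp − t_pp′)ε²)`. [folklore] -/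
theorem dcharCubic_node_mul_fsN1_sq {Δ tpd tpp c ε : ℝ} (hN1 : fsN1 tpd tpp c ε ≠ 0) :
    dcharCubic Δ tpd tpp c (xNode Δ tpd tpp c ε) (xNode Δ tpd tpp c ε) ε * fsN1 tpd tpp c ε ^ 2 =
      8 * (Δ + ε) * (tpd ^ 2 + tpp * ε) * (2 * tpd ^ 2 * (Δ + 2 * ε) + (tpp - c) * ε ^ 2) := by
  set xN := xNode Δ tpd tpp c ε with hxN
  have hx := two_fsN1_mul_xNode (Δ := Δ) hN1
  rw [← hxN] at hx
  have h1 : (Δ + 4 * c * xN + ε + 4 * tpp * xN) * fsN1 tpd tpp c ε = 4 * (Δ + ε) * (tpd ^ 2 + tpp * ε) := by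
    have e : (Δ + 4 * c * xN + ε + 4 * tpp * xN) * fsN1 tpd tpp c ε = (Δ + ε) * fsN1 tpd tpp c ε + 2 * (c + tpp) * (2 * fsN1 tpd tpp c ε * xN) := by
      ring
    rw [e, hx]
    unfold fsN1
    ring
  have h2 : (nodeGap Δ tpp c xN ε + ε) * fsN1 tpd tpp c ε = 2 * (2 * tpd ^ 2 * (Δ + 2 * ε) + (tpp - c) * ε ^ 2) := by
    have key := nodeGap_xNode (Δ := Δ) hN1
    rw [← hxN] at key
    have e : 4 * tpd ^ 2 + 2 * (tpp - c) * ε = fsN1 tpd tpp c ε := by unfold fsN1; ring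
    rw [e] at key
    have e2 : (nodeGap Δ tpp c xN ε + ε) * fsN1 tpd tpp c ε = nodeGap Δ tpp c xN ε * fsN1 tpd tpp c ε + ε * fsN1 tpd tpp c ε := by ring
    rw [e2, key]
    unfold fsN1
    ring
  rw [dcharCubic_diag_eq, hxN, dQuad_xNode (Δ := Δ) hN1, ← hxN, zero_add]
  calc (Δ + 4 * c * xN + ε + 4 * tpp * xN) * (nodeGap Δ tpp c xN ε + ε) * fsN1 tpd tpp c ε ^ 2
        = ((Δ + 4 * c * xN + ε + 4 * tpp * xN) * fsN1 tpd tpp c ε) * ((nodeGap Δ tpp c xN ε + ε) * fsN1 tpd tpp c ε) := by ring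
    _ = (4 * (Δ + ε) * (tpd ^ 2 + tpp * ε)) * (2 * (2 * tpd ^ 2 * (Δ + 2 * ε) + (tpp - c) * ε ^ 2)) := by rw [h1, h2]
    _ = 8 * (Δ + ε) * (tpd ^ 2 + tpp * ε) * (2 * tpd ^ 2 * (Δ + 2 * ε) + (tpp - c) * ε ^ 2) := by ring

/-- `scaleNodeD > 0` in the regime (`Δ + ε > 0`, `ε ≥ 0`, `0 ≤ t_pp′ ≤ t_pp`, `t_pd ≠ 0`). [folklore] -/
theorem scaleNodeD_pos {Δ tpd tpp c ε : ℝ} (hE : 0 < Δ + ε) (hε : 0 ≤ ε) (hc : 0 ≤ c) (hct : c ≤ tpp) (htpd : tpd ≠ 0) :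
    0 < scaleNodeD Δ tpd tpp c ε := by
  unfold scaleNodeD
  have ht : 0 < tpd ^ 2 := by positivity
  have htpp : 0 ≤ tpp := hc.trans hct
  have h1 : 0 < tpd ^ 2 + tpp * ε := by positivity
  have h2 : 0 < 2 * tpd ^ 2 * (Δ + 2 * ε) + (tpp - c) * ε ^ 2 := by
    have : 0 ≤ (tpp - c) * ε ^ 2 := mul_nonneg (sub_nonneg.2 hct) (sq_nonneg ε)
    have : 0 < Δ + 2 * ε := by linarith
    positivity
  positivity

/-- **THE NODAL SCALE IN CLOSED FORM**: `scaleT(xNode, xNode; ε) = scaleNodeN/scaleNodeD` (`fsN1 > 0`, `Δ + ε > 0`, `ε ≥ 0`, `0 ≤ t_pp′ ≤ t_pp`, `t_pd ≠ 0`). [folklore] -/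
theorem scaleT_node_eq {Δ tpd tpp c ε : ℝ} (hE : 0 < Δ + ε) (hε : 0 ≤ ε) (hc : 0 ≤ c) (hct : c ≤ tpp) (htpd : tpd ≠ 0) :
    scaleT Δ tpd tpp c (xNode Δ tpd tpp c ε) (xNode Δ tpd tpp c ε) ε = scaleNodeN Δ tpd tpp c ε / scaleNodeD Δ tpd tpp c ε := by
  have hN1 := fsN1_pos hct hε htpd
  have hD := scaleNodeD_pos hE hε hc hct htpd
  have hmul := dcharCubic_node_mul_fsN1_sq (Δ := Δ) hN1.ne'
  have hW : dcharCubic Δ tpd tpp c (xNode Δ tpd tpp c ε) (xNode Δ tpd tpp c ε) ε = 4 * scaleNodeD Δ tpd tpp c ε / fsN1 tpd tpp c ε ^ 2 := by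
    rw [eq_div_iff (by positivity), scaleNodeD]
    linear_combination hmul
  unfold scaleT
  rw [hW, div_div_eq_mul_div, div_eq_div_iff (by positivity) hD.ne', scaleNodeN, fsN1_eq_two_mul]
  ring

/-- The nodal scale is positive in the regime whenever `fsT > 0` (hole-like or electron-like alike; `fsT = fsD + 2fsN > 0` for `fsD > 0`, `fsN ≥ 0`). [folklore] -/
theorem scaleT_node_pos {Δ tpd tpp c ε : ℝ} (hE : 0 < Δ + ε) (hε : 0 ≤ ε) (hc : 0 ≤ c) (hct : c ≤ tpp) (htpd : tpd ≠ 0) (hm : c * ε < tpd ^ 2) :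
    0 < scaleT Δ tpd tpp c (xNode Δ tpd tpp c ε) (xNode Δ tpd tpp c ε) ε := by
  rw [scaleT_node_eq hE hε hc hct htpd]
  have hD := scaleNodeD_pos hE hε hc hct htpd
  have hT : 0 < fsT Δ tpd tpp c ε := by
    unfold fsT
    have := fsD_pos hE hm; have := fsN_nonneg (tpd := tpd) hc hct hε; positivity
  unfold scaleNodeN
  have hN1 := fsN1_pos hct hε htpd
  rw [fsN1_eq_two_mul] at hN1
  have : 0 < 2 * tpd ^ 2 + (tpp - c) * ε := by linarith
  positivity

end Summit.Ventures.CertifiedManyBodySolver.Downfold.Emery
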